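/- Width seat 2/3 `ym-line-cbag-p1-w2` (prover-ym-line-cbag-p1-w2-g21-0) of the cell of ideator ym-idea-2, LINE 8
(route `EguchiKawaiDirectionLadder`), post-closure glue for the barrier entry `EguchiKawaiBreakdown`: the finite
VARIANCE TENSORISATION (Efron–Stein) inequality used to show that in `d = 2` every open Wilson word of the Eguchi–Kawai
model vanishes at every coupling (`EguchiKawaiDirectionLadderWilsonWordsTwoDim.lean`).  Pure algebra, route-independent;
YM mass gap NOT touched (barrier-ledger line). -/
import Mathlib.Analysis.InnerProductSpace.Basic
import Mathlib.Algebra.Order.Chebyshev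
import Mathlib.Data.Fin.Tuple.Basic
import HarnessLib

/-!
# Variance tensorisation on a finite product (Efron–Stein), norm form

For a function `F : (Fin N → α) → E` on the finite product of `N` copies of a finite set `α` (uniform counting weights)
with values in a real inner product space `E`:

* `sum_norm_sub_mean_sq_le_two_factor` — the two-factor step: for `G : X → Y → E`,
  `Σ ‖G − mean‖² ≤ Σ ‖G − mean_X G‖² + Σ ‖G − mean_Y G‖²` (Pythagoras in `ℓ²(X × Y)` for the orthogonal splitting
  `G − mean = (G − mean_X G) + (mean_X G − mean)`, then Jensen for the second piece);
* `sum_norm_sub_mean_sq_le_sum_coord` — **Efron–Stein**: `Σ_m ‖F m − mean F‖² ≤ Σ_c Σ_m ‖F m − mean_c F m‖²`, where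
  `mean_c` averages the coordinate `c` (induction on `N` through `Fin.consEquiv`);
* `sum_norm_sq_le_of_sum_eq_zero` — the form used downstream: if `Σ_m F m = 0` then
  `Σ_m ‖F m‖² ≤ |α|⁻¹ Σ_c Σ_m Σ_a ‖F (update m c a) − F m‖²`.

All averages are written out (`(card)⁻¹ • Σ`), no definitions are introduced.  Reference for the inequality: B. Efron,
C. Stein, *The jackknife estimate of variance*, Ann. Statist. 9 (1981) 586–596 (tensorisation of variance); here only the
finite uniform case is needed and proved from scratch.
-/

set_option autoImplicit false

open scoped BigOperators RealInnerProductSpace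
open Finset

namespace Summit.QuantumFields.YangMills.Theorems.EguchiKawaiDirectionLadder

namespace FiniteAveraging

section Jensen

variable {E : Type*} [NormedAddCommGroup E]

/-! ### Jensen for a finite sum of vectors -/

/-- `‖Σ_a u_a‖² ≤ |α| · Σ_a ‖u_a‖²` (Cauchy–Schwarz). -/
theorem norm_sum_sq_le_card_mul {α : Type*} [Fintype α] (u : α → E) :
    ‖∑ a, u a‖ ^ 2 ≤ (Fintype.card α : ℝ) * ∑ a, ‖u a‖ ^ 2 := by
  calc ‖∑ a, u a‖ ^ 2 ≤ (∑ a, ‖u a‖) ^ 2 := by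
        gcongr
        exact norm_sum_le _ _
    _ ≤ (#(Finset.univ : Finset α) : ℝ) * ∑ a, ‖u a‖ ^ 2 := sq_sum_le_card_mul_sum_sq
    _ = (Fintype.card α : ℝ) * ∑ a, ‖u a‖ ^ 2 := by rw [Finset.card_univ]

variable [NormedSpace ℝ E]

/-- The averaged form: `‖|α|⁻¹ • Σ_a u_a‖² ≤ |α|⁻¹ · Σ_a ‖u_a‖²`. -/
theorem norm_smul_sum_sq_le {α : Type*} [Fintype α] [Nonempty α] (u : α → E) :
    ‖(Fintype.card α : ℝ)⁻¹ • ∑ a, u a‖ ^ 2 ≤ (Fintype.card α : ℝ)⁻¹ * ∑ a, ‖u a‖ ^ 2 := by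
  have hc : (0 : ℝ) < Fintype.card α := Nat.cast_pos.2 Fintype.card_pos
  rw [norm_smul, mul_pow, norm_inv, Real.norm_natCast]
  calc (Fintype.card α : ℝ)⁻¹ ^ 2 * ‖∑ a, u a‖ ^ 2
      ≤ (Fintype.card α : ℝ)⁻¹ ^ 2 * ((Fintype.card α : ℝ) * ∑ a, ‖u a‖ ^ 2) :=
        mul_le_mul_of_nonneg_left (norm_sum_sq_le_card_mul u) (by positivity)
    _ = (Fintype.card α : ℝ)⁻¹ * ∑ a, ‖u a‖ ^ 2 := by
        field_simp

/-- `|α| • (|α|⁻¹ • v) = v` in the form `Σ_a |α|⁻¹ • v = v`. -/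
theorem sum_const_smul_inv_card {α : Type*} [Fintype α] [Nonempty α] (v : E) :
    ∑ _a : α, (Fintype.card α : ℝ)⁻¹ • v = v := by
  have hc : (Fintype.card α : ℝ) ≠ 0 := Nat.cast_ne_zero.2 Fintype.card_ne_zero
  rw [Finset.sum_const, Finset.card_univ, ← Nat.cast_smul_eq_nsmul ℝ, smul_smul, mul_inv_cancel₀ hc, one_smul]

/-- The deviations from the mean sum to zero: `Σ_a (u_a − |α|⁻¹ Σ_b u_b) = 0`. -/
theorem sum_sub_mean_eq_zero {α : Type*} [Fintype α] [Nonempty α] (u : α → E) :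
    ∑ a, (u a - (Fintype.card α : ℝ)⁻¹ • ∑ b, u b) = 0 := by
  rw [Finset.sum_sub_distrib, sum_const_smul_inv_card, sub_self]

end Jensen

section EfronStein

variable {E : Type*} [NormedAddCommGroup E] [InnerProductSpace ℝ E]

/-! ### The two-factor step -/

/-- **Two-factor variance splitting.**  For `G : X → Y → E` on a product of two finite sets,
`Σ_{x,y} ‖G x y − mean‖² ≤ Σ_{x,y} ‖G x y − |X|⁻¹ Σ_{x'} G x' y‖² + Σ_{x,y} ‖G x y − |Y|⁻¹ Σ_{y'} G x y'‖²`.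
Proof: `G − mean = (G − mean_X G) + (mean_X G − mean)`; for fixed `y` the first piece sums to zero over `x` while the second
does not depend on `x`, so the two are orthogonal in `ℓ²(X × Y)` (Pythagoras); and `mean_X G y − mean = |X|⁻¹ Σ_x (G x y −
mean_Y G x)` is bounded by Jensen. -/
theorem sum_norm_sub_mean_sq_le_two_factor {X Y : Type*} [Fintype X] [Fintype Y] [Nonempty X] [Nonempty Y]
    (G : X → Y → E) :
    ∑ x, ∑ y, ‖G x y - ((Fintype.card X : ℝ) * Fintype.card Y)⁻¹ • ∑ x', ∑ y', G x' y'‖ ^ 2 ≤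
      (∑ x, ∑ y, ‖G x y - (Fintype.card X : ℝ)⁻¹ • ∑ x', G x' y‖ ^ 2) +
        ∑ x, ∑ y, ‖G x y - (Fintype.card Y : ℝ)⁻¹ • ∑ y', G x y'‖ ^ 2 := by
  set cX : ℝ := (Fintype.card X : ℝ) with hcX
  set cY : ℝ := (Fintype.card Y : ℝ) with hcY
  have hX : cX ≠ 0 := by rw [hcX]; exact Nat.cast_ne_zero.2 Fintype.card_ne_zero
  have hY : cY ≠ 0 := by rw [hcY]; exact Nat.cast_ne_zero.2 Fintype.card_ne_zero
  have hXpos : 0 < cX := by rw [hcX]; exact Nat.cast_pos.2 Fintype.card_pos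
  set AX : Y → E := fun y => cX⁻¹ • ∑ x', G x' y with hAX
  set AY : X → E := fun x => cY⁻¹ • ∑ y', G x y' with hAY
  set μ : E := (cX * cY)⁻¹ • ∑ x', ∑ y', G x' y' with hμ
  -- (1) for fixed `y` the deviations from the `X`-mean sum to zero
  have h1 : ∀ y, ∑ x, (G x y - AX y) = 0 := fun y => sum_sub_mean_eq_zero (fun x => G x y)
  -- (2) `AX y − μ = |X|⁻¹ Σ_x (G x y − AY x)`
  have h2 : ∀ y, AX y - μ = cX⁻¹ • ∑ x, (G x y - AY x) := by
    intro y
    rw [Finset.sum_sub_distrib, smul_sub, hAX, hμ]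
    congr 1
    rw [hAY]
    simp only
    rw [← Finset.smul_sum, smul_smul, mul_inv]
  -- (3) Pythagoras in `x` for fixed `y`
  have h3 : ∀ y, ∑ x, ‖G x y - μ‖ ^ 2 = (∑ x, ‖G x y - AX y‖ ^ 2) + cX * ‖AX y - μ‖ ^ 2 := by
    intro y
    have hsplit : ∀ x, G x y - μ = (G x y - AX y) + (AX y - μ) := fun x => by abel
    simp_rw [hsplit, norm_add_sq_real]
    rw [Finset.sum_add_distrib, Finset.sum_add_distrib, ← Finset.mul_sum, ← sum_inner, h1 y, inner_zero_left,
      mul_zero, add_zero, Finset.sum_const, Finset.card_univ, nsmul_eq_mul, hcX]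
  -- (4) Jensen for the second piece
  have h4 : ∀ y, cX * ‖AX y - μ‖ ^ 2 ≤ ∑ x, ‖G x y - AY x‖ ^ 2 := by
    intro y
    rw [h2 y]
    have hj := norm_smul_sum_sq_le (fun x => G x y - AY x)
    rw [← hcX] at hj
    calc cX * ‖cX⁻¹ • ∑ x, (G x y - AY x)‖ ^ 2 ≤ cX * (cX⁻¹ * ∑ x, ‖G x y - AY x‖ ^ 2) :=
          mul_le_mul_of_nonneg_left hj hXpos.le
      _ = ∑ x, ‖G x y - AY x‖ ^ 2 := by rw [← mul_assoc, mul_inv_cancel₀ hX, one_mul]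
  -- (5) assemble: swap the order of summation to work at fixed `y`
  calc ∑ x, ∑ y, ‖G x y - μ‖ ^ 2 = ∑ y, ∑ x, ‖G x y - μ‖ ^ 2 := Finset.sum_comm
    _ = ∑ y, ((∑ x, ‖G x y - AX y‖ ^ 2) + cX * ‖AX y - μ‖ ^ 2) := Finset.sum_congr rfl fun y _ => h3 y
    _ ≤ ∑ y, ((∑ x, ‖G x y - AX y‖ ^ 2) + ∑ x, ‖G x y - AY x‖ ^ 2) :=
        Finset.sum_le_sum fun y _ => by gcongr; exact h4 y
    _ = (∑ x, ∑ y, ‖G x y - AX y‖ ^ 2) + ∑ x, ∑ y, ‖G x y - AY x‖ ^ 2 := by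
        rw [Finset.sum_add_distrib, Finset.sum_comm, Finset.sum_comm (f := fun y x => ‖G x y - AY x‖ ^ 2)]

/-! ### Efron–Stein on `Fin N → α` -/

/-- **Efron–Stein (variance tensorisation) on the finite product `Fin N → α` with uniform weights**:
`Σ_m ‖F m − mean F‖² ≤ Σ_{c < N} Σ_m ‖F m − |α|⁻¹ Σ_a F(m[c ↦ a])‖²` — the variance is at most the sum over coordinates of the
one-coordinate variances.  Induction on `N`: split off coordinate `0` by `Fin.consEquiv` and use the two-factor step. -/
theorem sum_norm_sub_mean_sq_le_sum_coord {α : Type*} [Fintype α] [Nonempty α] [DecidableEq α] :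
    ∀ (N : ℕ) (F : (Fin N → α) → E),
      ∑ m, ‖F m - (Fintype.card (Fin N → α) : ℝ)⁻¹ • ∑ m', F m'‖ ^ 2 ≤
        ∑ c : Fin N, ∑ m, ‖F m - (Fintype.card α : ℝ)⁻¹ • ∑ a, F (Function.update m c a)‖ ^ 2 := by
  intro N
  induction N with
  | zero =>
      intro F
      have hsub : ∀ m m' : Fin 0 → α, m = m' := fun m m' => Subsingleton.elim m m'
      have hcard : Fintype.card (Fin 0 → α) = 1 := Fintype.card_unique
      have hsum : ∑ m' : Fin 0 → α, F m' = F default := Fintype.sum_unique _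
      simp only [hcard, hsum, Nat.cast_one, inv_one, one_smul, Finset.univ_eq_empty, Finset.sum_empty]
      refine le_of_eq (Finset.sum_eq_zero fun m _ => ?_)
      rw [hsub m default, sub_self, norm_zero]
      simp
  | succ N ih =>
      intro F
      set e : α × (Fin N → α) ≃ (Fin (N + 1) → α) := Fin.consEquiv fun _ => α with he
      have he_apply : ∀ x (y : Fin N → α), e (x, y) = Fin.cons x y := fun x y => rfl
      -- transport every sum over `Fin (N+1) → α` to a double sum over `α × (Fin N → α)`
      have hsum : ∀ f : (Fin (N + 1) → α) → E, ∑ m, f m = ∑ x : α, ∑ y : Fin N → α, f (Fin.cons x y) := by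
        intro f
        rw [← Fintype.sum_equiv e (fun p => f (e p)) f (fun p => rfl), Fintype.sum_prod_type]
        simp only [he_apply]
      have hsumR : ∀ f : (Fin (N + 1) → α) → ℝ, ∑ m, f m = ∑ x : α, ∑ y : Fin N → α, f (Fin.cons x y) := by
        intro f
        rw [← Fintype.sum_equiv e (fun p => f (e p)) f (fun p => rfl), Fintype.sum_prod_type]
        simp only [he_apply]
      have hcard : (Fintype.card (Fin (N + 1) → α) : ℝ) = (Fintype.card α : ℝ) * Fintype.card (Fin N → α) := by
        rw [← Fintype.card_congr e, Fintype.card_prod, Nat.cast_mul]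
      -- the two-factor step for `G x y = F (cons x y)`
      have htf := sum_norm_sub_mean_sq_le_two_factor (fun (x : α) (y : Fin N → α) => F (Fin.cons x y))
      -- the induction hypothesis at fixed first coordinate
      have hih : ∀ x : α, ∑ y : Fin N → α, ‖F (Fin.cons x y) -
            (Fintype.card (Fin N → α) : ℝ)⁻¹ • ∑ y', F (Fin.cons x y')‖ ^ 2 ≤
          ∑ c : Fin N, ∑ y : Fin N → α, ‖F (Fin.cons x y) -
            (Fintype.card α : ℝ)⁻¹ • ∑ a, F (Function.update (Fin.cons x y : Fin (N + 1) → α) c.succ a)‖ ^ 2 := by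
        intro x
        have h := ih (fun y => F (Fin.cons x y))
        simp only [Fin.cons_update] at h
        exact h
      -- rewrite the goal in product coordinates
      rw [hsumR, hsum, hcard]
      refine htf.trans ?_
      rw [Fin.sum_univ_succ, hsumR]
      simp only [Fin.update_cons_zero]
      -- coordinate `0`: `Σ_{x'} F (cons x' y) = Σ_a F (update (cons x y) 0 a)` is literally the same sum;
      -- coordinates `succ c`: induction hypothesis, then exchange `Σ_x Σ_c = Σ_c Σ_x`
      refine add_le_add le_rfl ?_
      calc ∑ x, ∑ y : Fin N → α, ‖F (Fin.cons x y) -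
            (Fintype.card (Fin N → α) : ℝ)⁻¹ • ∑ y', F (Fin.cons x y')‖ ^ 2
          ≤ ∑ x, ∑ c : Fin N, ∑ y : Fin N → α, ‖F (Fin.cons x y) -
            (Fintype.card α : ℝ)⁻¹ • ∑ a, F (Function.update (Fin.cons x y : Fin (N + 1) → α) c.succ a)‖ ^ 2 :=
            Finset.sum_le_sum fun x _ => hih x
        _ = ∑ c : Fin N, ∑ m : Fin (N + 1) → α, ‖F m -
            (Fintype.card α : ℝ)⁻¹ • ∑ a, F (Function.update m c.succ a)‖ ^ 2 := by
            rw [Finset.sum_comm]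
            refine Finset.sum_congr rfl fun c _ => ?_
            rw [hsumR]

/-- **Mean-zero form with the one-coordinate variances bounded by Jensen**: if `Σ_m F m = 0` then
`Σ_m ‖F m‖² ≤ |α|⁻¹ · Σ_c Σ_m Σ_a ‖F(m[c ↦ a]) − F m‖²`. -/
theorem sum_norm_sq_le_of_sum_eq_zero {α : Type*} [Fintype α] [Nonempty α] [DecidableEq α] {N : ℕ}
    (F : (Fin N → α) → E) (h0 : ∑ m, F m = 0) :
    ∑ m, ‖F m‖ ^ 2 ≤
      (Fintype.card α : ℝ)⁻¹ * ∑ c : Fin N, ∑ m, ∑ a, ‖F (Function.update m c a) - F m‖ ^ 2 := by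
  have h := sum_norm_sub_mean_sq_le_sum_coord N F
  simp only [h0, smul_zero, sub_zero] at h
  refine h.trans ?_
  rw [Finset.mul_sum]
  refine Finset.sum_le_sum fun c _ => ?_
  rw [Finset.mul_sum]
  refine Finset.sum_le_sum fun m _ => ?_
  -- `F m − |α|⁻¹ Σ_a F(m[c↦a]) = |α|⁻¹ Σ_a (F m − F(m[c↦a]))`, then Jensen
  have hc : (Fintype.card α : ℝ) ≠ 0 := Nat.cast_ne_zero.2 Fintype.card_ne_zero
  have hconst : (Fintype.card α : ℝ)⁻¹ • ∑ _a : α, F m = F m := by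
    rw [Finset.sum_const, Finset.card_univ, ← Nat.cast_smul_eq_nsmul ℝ, smul_smul, inv_mul_cancel₀ hc, one_smul]
  have hrw : F m - (Fintype.card α : ℝ)⁻¹ • ∑ a, F (Function.update m c a) =
      (Fintype.card α : ℝ)⁻¹ • ∑ a, (F m - F (Function.update m c a)) := by
    rw [Finset.sum_sub_distrib, smul_sub, hconst]
  rw [hrw]
  refine (norm_smul_sum_sq_le _).trans (le_of_eq ?_)
  congr 1
  exact Finset.sum_congr rfl fun a _ => by rw [norm_sub_rev]

end EfronStein

end FiniteAveraging

end Summit.QuantumFields.YangMills.Theorems.EguchiKawaiDirectionLadder
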